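import Summits.QuantumFields.YangMills.Theorems.QuantileBitPurityFluxReflectionEven
import Summits.QuantumFields.YangMills.Theorems.QuantileBitPurityFluxReflectionOdd
import HarnessLib

/-!
# Crux `CentreWallReflection.WallReflection` ⟨stmt-QuantumFields-23707⟩, line `birth` (planner ym-idea-4 g18, LINE g18-A): the registered
# stubs `stub_evenRing` and `stub_oddRing` — CLOSED (wall-labelled flux reflection, even and odd rings)

The two abstract ring lemmas of the K1 skeleton (`bc/g18-A/bc/WallReflection_birth.lean`), proved as stated.  They generalise the landed
SU(2) sign-bit lemmas `FemtoTransferGap.FluxReflection.twisted_le_even/odd` (`Theorems/QuantileBitPurityFluxReflection{Even,Odd}.lean`): the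
odd REAL bit `O ∘ T = −O` with zero set `{O = 0}` is replaced by an `ℕ`-valued SECTOR LABEL `O` that must change under the seam map `T` off a
WALL event `W₀` (`y ∉ W₀ → O (T y) ≠ O y`); in the odd ring the band hypothesis is replaced by WALL-LOCALITY on close pairs
(`(a,a') ∈ Cl → a ∉ W₀ → a' ∉ W₀ → O a = O a'`), and each one-sided wall insertion is untwisted by Cauchy–Schwarz in the `K`-form (`cs_term`),
whence the extra square-root wall term.

* `one_le_wallBracket0`, ★ `stub_evenRing : EvenRingP` —
  `∫Ψ(x,a)Ψ(a,Tx) ≤ (∫ΨΨ)^{1/2}·(2(∫Ψ𝟙_{O a ≠ O x}Ψ)^{1/2} + (∫Ψ𝟙_{W₀}(x)Ψ)^{1/2})`;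
* `one_le_wallBracket`, ★ `stub_oddRing : OddRingP` —
  `∫ΨKΨ(·,T·) ≤ (∫ΨKΨ)^{1/2}·(2√flip + √wall(x) + 2(∫Ψ𝟙_{W₀}K𝟙_{W₀}Ψ)^{1/2}) + ∫ΨK𝟙_{Clᶜ}Ψ(·,T·)`.

All weights, measurability and Cauchy–Schwarz steps are the landed API (`weight0_mono/add`, `cs_term0`, `weight_mono/add`, `cs_term`,
`weight_eq_pq(_id)`); only the brackets are new.  Pure measure theory (Mathlib only).  HONEST FRAMING: inequalities between integrals on an
abstract finite measure space; the lattice instantiation `stub_instantiate`, the crux `WallReflection`, the route's target and the Yang–Mills mass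
gap are NOT proved here.  No `sorry`, no new axiom; the two `abbrev`s are registered-stub copies (verbatim), not citable facts.
References: [folklore] (Cauchy–Schwarz); E. T. Tomboulis, L. G. Yaffe, CMP 100 (1985) 313; [cite: tHooft1979].
-/

set_option autoImplicit false

noncomputable section

open MeasureTheory Real Function Set
open Summit.QuantumFields.YangMills.Theorems.FemtoTransferGap.FluxReflection

namespace Summit.QuantumFields.YangMills.Theorems.CentreWallReflection

/-! ## §1 Registered stub statements (verbatim copies of the skeleton's `EvenRingP`, `OddRingP`) -/

/-- STUB 1 statement of the birth skeleton of crux ⟨stmt-QuantumFields-23707⟩ (verbatim copy of `CentreWallReflectionBirthK1.EvenRingP`; a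
registered-stub copy, not a citable fact): even-ring flux reflection for a wall-labelled sector. -/
abbrev EvenRingP : Prop :=
  ∀ (Y : Type) [MeasurableSpace Y] (ρ : MeasureTheory.Measure Y) [MeasureTheory.IsFiniteMeasure ρ]
    (Ψ : Y → Y → ℝ) (CΨ : ℝ), Measurable (Function.uncurry Ψ) → (∀ x a, |Ψ x a| ≤ CΨ) → (∀ x a, 0 ≤ Ψ x a) →
    (∀ x a, Ψ x a = Ψ a x) →
    ∀ (T : Y → Y), MeasureTheory.MeasurePreserving T ρ ρ →
    ∀ (O : Y → ℕ) (W₀ : Set Y), Measurable O → MeasurableSet W₀ → (∀ y, y ∉ W₀ → O (T y) ≠ O y) →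
    ∫ x, ∫ a, Ψ x a * Ψ a (T x) ∂ρ ∂ρ ≤
      Real.sqrt (∫ x, ∫ a, Ψ x a * Ψ a x ∂ρ ∂ρ) *
        (2 * Real.sqrt (∫ x, ∫ a, Ψ x a * {b | O b ≠ O x}.indicator (fun _ => (1 : ℝ)) a * Ψ a x ∂ρ ∂ρ) +
          Real.sqrt (∫ x, ∫ a, Ψ x a * W₀.indicator (fun _ => (1 : ℝ)) x * Ψ a x ∂ρ ∂ρ))

/-- STUB 2 statement of the birth skeleton of crux ⟨stmt-QuantumFields-23707⟩ (verbatim copy of `CentreWallReflectionBirthK1.OddRingP`; a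
registered-stub copy, not a citable fact): odd-ring flux reflection with a positive semi-definite middle-bond kernel and wall-locality. -/
abbrev OddRingP : Prop :=
  ∀ (Y : Type) [MeasurableSpace Y] (ρ : MeasureTheory.Measure Y) [MeasureTheory.IsFiniteMeasure ρ]
    (Ψ K : Y → Y → ℝ) (CΨ CK : ℝ), Measurable (Function.uncurry Ψ) → (∀ x a, |Ψ x a| ≤ CΨ) → (∀ x a, 0 ≤ Ψ x a) →
    (∀ x a, Ψ x a = Ψ a x) →
    Measurable (Function.uncurry K) → (∀ a a', |K a a'| ≤ CK) → (∀ a a', 0 ≤ K a a') → (∀ a a', K a a' = K a' a) →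
    (∀ φ : Y → ℝ, Measurable φ → ∀ C : ℝ, (∀ a, |φ a| ≤ C) → 0 ≤ ∫ a, ∫ a', φ a * K a a' * φ a' ∂ρ ∂ρ) →
    ∀ (T : Y → Y), MeasureTheory.MeasurePreserving T ρ ρ →
    ∀ (O : Y → ℕ) (W₀ : Set Y), Measurable O → MeasurableSet W₀ → (∀ y, y ∉ W₀ → O (T y) ≠ O y) →
    ∀ (Cl : Set (Y × Y)), MeasurableSet Cl → (∀ a a', (a, a') ∈ Cl → a ∉ W₀ → a' ∉ W₀ → O a = O a') →
    ∫ x, ∫ a, Ψ x a * ∫ a', K a a' * Ψ a' (T x) ∂ρ ∂ρ ∂ρ ≤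
      Real.sqrt (∫ x, ∫ a, Ψ x a * ∫ a', K a a' * Ψ a' x ∂ρ ∂ρ ∂ρ) *
          (2 * Real.sqrt (∫ x, ∫ a, Ψ x a * ∫ a', K a a' *
              ({b | O b ≠ O x}.indicator (fun _ => (1 : ℝ)) a * {b | O b ≠ O x}.indicator (fun _ => (1 : ℝ)) a') * Ψ a' x ∂ρ ∂ρ ∂ρ) +
            Real.sqrt (∫ x, ∫ a, Ψ x a * ∫ a', K a a' * W₀.indicator (fun _ => (1 : ℝ)) x * Ψ a' x ∂ρ ∂ρ ∂ρ) +
            2 * Real.sqrt (∫ x, ∫ a, Ψ x a * ∫ a', K a a' *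
              (W₀.indicator (fun _ => (1 : ℝ)) a * W₀.indicator (fun _ => (1 : ℝ)) a') * Ψ a' x ∂ρ ∂ρ ∂ρ)) +
        ∫ x, ∫ a, Ψ x a * ∫ a', K a a' * Clᶜ.indicator (fun _ => (1 : ℝ)) (a, a') * Ψ a' (T x) ∂ρ ∂ρ ∂ρ

/-! ## §2 The wall brackets and the label-flip indicator -/

section Brackets

variable {Y : Type*}

/-- The even wall bracket: the base point is on the wall, or the label flips on one of the two halves (`x ∉ W₀ ⇒ O(Tx) ≠ O x`, so `O a`
cannot agree with both). [folklore] -/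
theorem one_le_wallBracket0 {T : Y → Y} {O : Y → ℕ} {W₀ : Set Y} (hOT : ∀ y, y ∉ W₀ → O (T y) ≠ O y) (x a : Y) :
    (1 : ℝ) ≤ W₀.indicator (fun _ => (1 : ℝ)) x + {b | O b ≠ O x}.indicator (fun _ => (1 : ℝ)) a +
      {b | O b ≠ O (T x)}.indicator (fun _ => (1 : ℝ)) a := by
  have h0 : ∀ (s : Set Y) (y : Y), 0 ≤ s.indicator (fun _ => (1 : ℝ)) y := fun s y => Set.indicator_nonneg (fun _ _ => zero_le_one) _
  by_cases hx : x ∈ W₀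
  · have : W₀.indicator (fun _ => (1 : ℝ)) x = 1 := Set.indicator_of_mem hx _
    linarith [h0 {b | O b ≠ O x} a, h0 {b | O b ≠ O (T x)} a]
  by_cases ha : O a = O x
  · have hne : O a ≠ O (T x) := by rw [ha]; exact fun h => hOT x hx h.symm
    have : {b | O b ≠ O (T x)}.indicator (fun _ => (1 : ℝ)) a = 1 := Set.indicator_of_mem (by exact hne) _
    linarith [h0 W₀ x, h0 {b | O b ≠ O x} a]
  · have : {b | O b ≠ O x}.indicator (fun _ => (1 : ℝ)) a = 1 := Set.indicator_of_mem (by exact ha) _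
    linarith [h0 W₀ x, h0 {b | O b ≠ O (T x)} a]

/-- The odd wall bracket: the base point is on the wall, or the label flips on the first half, or on the second half, or across the middle
bond — and a middle flip across a CLOSE bond with both ends off the wall is excluded by wall-locality, so the middle alternative is
`𝟙_{Clᶜ}(a,a') + 𝟙_{W₀}(a) + 𝟙_{W₀}(a')`. [folklore] -/
theorem one_le_wallBracket {T : Y → Y} {O : Y → ℕ} {W₀ : Set Y} {Cl : Set (Y × Y)} (hOT : ∀ y, y ∉ W₀ → O (T y) ≠ O y)
    (hloc : ∀ a a', (a, a') ∈ Cl → a ∉ W₀ → a' ∉ W₀ → O a = O a') (x a a' : Y) :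
    (1 : ℝ) ≤ W₀.indicator (fun _ => (1 : ℝ)) x + {b | O b ≠ O x}.indicator (fun _ => (1 : ℝ)) a +
      {b | O b ≠ O (T x)}.indicator (fun _ => (1 : ℝ)) a' +
      (Clᶜ.indicator (fun _ => (1 : ℝ)) (a, a') + W₀.indicator (fun _ => (1 : ℝ)) a + W₀.indicator (fun _ => (1 : ℝ)) a') := by
  have h0 : ∀ (s : Set Y) (y : Y), 0 ≤ s.indicator (fun _ => (1 : ℝ)) y := fun s y => Set.indicator_nonneg (fun _ _ => zero_le_one) _
  have h0' : 0 ≤ Clᶜ.indicator (fun _ => (1 : ℝ)) (a, a') := Set.indicator_nonneg (fun _ _ => zero_le_one) _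
  by_cases hx : x ∈ W₀
  · have : W₀.indicator (fun _ => (1 : ℝ)) x = 1 := Set.indicator_of_mem hx _
    linarith [h0 {b | O b ≠ O x} a, h0 {b | O b ≠ O (T x)} a', h0 W₀ a, h0 W₀ a']
  by_cases ha : O a = O x
  · by_cases ha' : O a' = O (T x)
    · -- a middle flip: `O a = O x ≠ O (T x) = O a'`
      have hne : O a ≠ O a' := by rw [ha, ha']; exact fun h => hOT x hx h.symm
      by_cases hc : (a, a') ∈ Cl
      · by_cases hwa : a ∈ W₀
        · have : W₀.indicator (fun _ => (1 : ℝ)) a = 1 := Set.indicator_of_mem hwa _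
          linarith [h0 W₀ x, h0 {b | O b ≠ O x} a, h0 {b | O b ≠ O (T x)} a', h0 W₀ a']
        by_cases hwa' : a' ∈ W₀
        · have : W₀.indicator (fun _ => (1 : ℝ)) a' = 1 := Set.indicator_of_mem hwa' _
          linarith [h0 W₀ x, h0 {b | O b ≠ O x} a, h0 {b | O b ≠ O (T x)} a', h0 W₀ a]
        exact absurd (hloc a a' hc hwa hwa') hne
      · have : Clᶜ.indicator (fun _ => (1 : ℝ)) (a, a') = 1 := Set.indicator_of_mem (show (a, a') ∈ Clᶜ from hc) _
        linarith [h0 W₀ x, h0 {b | O b ≠ O x} a, h0 {b | O b ≠ O (T x)} a', h0 W₀ a, h0 W₀ a']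
    · have : {b | O b ≠ O (T x)}.indicator (fun _ => (1 : ℝ)) a' = 1 := Set.indicator_of_mem (by exact ha') _
      linarith [h0 W₀ x, h0 {b | O b ≠ O x} a, h0 W₀ a, h0 W₀ a']
  · have : {b | O b ≠ O x}.indicator (fun _ => (1 : ℝ)) a = 1 := Set.indicator_of_mem (by exact ha) _
    linarith [h0 W₀ x, h0 {b | O b ≠ O (T x)} a', h0 W₀ a, h0 W₀ a']

/-- The label-flip indicator `(x, b) ↦ 𝟙{O b ≠ O x}` of an `ℕ`-valued measurable label is jointly measurable. [folklore] -/
theorem measurable_flipIndNat [MeasurableSpace Y] {O : Y → ℕ} (hOm : Measurable O) :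
    Measurable fun p : Y × Y => {b | O b ≠ O p.1}.indicator (fun _ => (1 : ℝ)) p.2 := by
  have h : (fun p : Y × Y => {b | O b ≠ O p.1}.indicator (fun _ => (1 : ℝ)) p.2) = {p : Y × Y | O p.2 ≠ O p.1}.indicator fun _ => (1 : ℝ) := by
    funext p
    simp only [Set.indicator_apply, Set.mem_setOf_eq]
  rw [h]
  exact measurable_const.indicator ((measurableSet_eq_fun (hOm.comp measurable_snd) (hOm.comp measurable_fst)).compl)

end Brackets

/-! ## §3 The even ring -/

/-- ★ **`stub_evenRing`** (registered stub of the birth skeleton of crux ⟨stmt-QuantumFields-23707⟩, signature `EvenRingP` verbatim):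
flux reflection on an even ring for a wall-labelled sector,
`∫Ψ(x,a)Ψ(a,Tx) ≤ (∫ΨΨ)^{1/2}·(2(∫Ψ𝟙_{O a ≠ O x}Ψ)^{1/2} + (∫Ψ𝟙_{W₀}(x)Ψ)^{1/2})` — the landed `twisted_le_even` with the wall bracket
`one_le_wallBracket0`. [folklore] -/
theorem stub_evenRing : EvenRingP := by
  intro Y _ ρ _ Ψ CΨ hΨm hΨb hΨ0 hΨs T hT O W₀ hOm hW hOT
  have hTm : Measurable T := hT.measurable
  set z : Y → ℝ := fun x => W₀.indicator (fun _ => (1 : ℝ)) x with hz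
  set fl : Y → Y → ℝ := fun x b => {b | O b ≠ O x}.indicator (fun _ => (1 : ℝ)) b with hfl
  have hzm : Measurable z := measurable_const.indicator hW
  have hflm : Measurable (uncurry fl) := measurable_flipIndNat hOm
  have mH0 : Measurable (uncurry fun _ _ : Y => (1 : ℝ)) := measurable_const
  have mZ : Measurable (uncurry fun x _ : Y => z x) := hzm.comp measurable_fst
  have mF2 : Measurable (uncurry fun x a : Y => fl (T x) a) := hflm.comp ((hTm.comp measurable_fst).prodMk measurable_snd)
  have b1 : ∀ (s : Set Y) (y : Y), |s.indicator (fun _ => (1 : ℝ)) y| ≤ 1 := abs_ind_le_one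
  have bZ : ∀ x a : Y, |z x| ≤ 1 := fun x _ => b1 _ x
  have bF1 : ∀ x a : Y, |fl x a| ≤ 1 := fun x a => b1 _ a
  have bF2 : ∀ x a : Y, |fl (T x) a| ≤ 1 := fun x a => b1 _ a
  have bH0 : ∀ x a : Y, |(1 : ℝ)| ≤ 1 := fun _ _ => by simp
  have bZF : ∀ x a : Y, |z x + fl x a| ≤ 2 := fun x a => by linarith [abs_add_le (z x) (fl x a), bZ x a, bF1 x a]
  have bBr : ∀ x a : Y, |z x + fl x a + fl (T x) a| ≤ 3 := fun x a => by
    linarith [abs_add_le (z x + fl x a) (fl (T x) a), bZF x a, bF2 x a]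
  have hz0 : ∀ x a : Y, 0 ≤ z x := fun x _ => ind_nonneg _ x
  have hz1 : ∀ x a : Y, z x ≤ 1 := fun x _ => ind_le_one _ x
  have hfl0 : ∀ x a : Y, 0 ≤ fl x a := fun x a => ind_nonneg _ a
  have hfl1 : ∀ x a : Y, fl x a ≤ 1 := fun x a => ind_le_one _ a
  -- Step 1/2: bracket and split
  have step1 : ∫ x, ∫ a, Ψ x a * 1 * Ψ a (T x) ∂ρ ∂ρ ≤ ∫ x, ∫ a, Ψ x a * (z x + fl x a + fl (T x) a) * Ψ a (T x) ∂ρ ∂ρ :=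
    weight0_mono (H := fun _ _ => (1 : ℝ)) (H' := fun x a => z x + fl x a + fl (T x) a) hΨm hΨb hΨ0 mH0 ((mZ.add hflm).add mF2) bH0 bBr
      (fun x a => one_le_wallBracket0 hOT x a) hTm
  have e0 : ∫ x, ∫ a, Ψ x a * 1 * Ψ a (T x) ∂ρ ∂ρ = ∫ x, ∫ a, Ψ x a * Ψ a (T x) ∂ρ ∂ρ := by simp only [mul_one]
  have e2a : ∫ x, ∫ a, Ψ x a * (z x + fl x a + fl (T x) a) * Ψ a (T x) ∂ρ ∂ρ =
      (∫ x, ∫ a, Ψ x a * (z x + fl x a) * Ψ a (T x) ∂ρ ∂ρ) + ∫ x, ∫ a, Ψ x a * fl (T x) a * Ψ a (T x) ∂ρ ∂ρ :=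
    weight0_add (H := fun x a => z x + fl x a) (H' := fun x a => fl (T x) a) hΨm hΨb (mZ.add hflm) mF2 bZF bF2 hTm
  have e2b : ∫ x, ∫ a, Ψ x a * (z x + fl x a) * Ψ a (T x) ∂ρ ∂ρ =
      (∫ x, ∫ a, Ψ x a * z x * Ψ a (T x) ∂ρ ∂ρ) + ∫ x, ∫ a, Ψ x a * fl x a * Ψ a (T x) ∂ρ ∂ρ :=
    weight0_add (H := fun x _ => z x) (H' := fun x a => fl x a) hΨm hΨb mZ hflm bZ bF1 hTm
  -- Step 3: Cauchy–Schwarz terms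
  have E1 := cs_term0 (ρ := ρ) (f := fun x _ => z x) (g := fun _ _ => (1 : ℝ)) hΨm hΨb hΨ0 hΨs hT mZ mH0 hz0 hz1
    (fun _ _ => zero_le_one) (fun _ _ => le_rfl)
  have cz1 : ∫ x, ∫ a, Ψ x a * z x * Ψ a (T x) ∂ρ ∂ρ = ∫ x, ∫ a, (Ψ x a * z x) * (Ψ a (T x) * 1) ∂ρ ∂ρ :=
    weight0_eq_pq (fun x _ => z x) (fun _ _ => (1 : ℝ)) (fun x _ => z x) T (fun _ _ => by ring)
  have cz2 : ∫ x, ∫ a, Ψ x a * z x * Ψ a x ∂ρ ∂ρ = ∫ x, ∫ a, (Ψ x a * z x) * (Ψ a x * z x) ∂ρ ∂ρ :=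
    weight0_eq_pq (fun x _ => z x) (fun x _ => z x) (fun x _ => z x) (fun x => x) (fun x _ => by rw [ind_mul_self])
  have c11 : ∫ x, ∫ a, Ψ x a * Ψ a x ∂ρ ∂ρ = ∫ x, ∫ a, (Ψ x a * 1) * (Ψ a x * 1) ∂ρ ∂ρ := by simp only [mul_one]
  rw [← cz1, ← cz2, ← c11] at E1
  have E2 := cs_term0 (ρ := ρ) (f := fun x a => fl x a) (g := fun _ _ => (1 : ℝ)) hΨm hΨb hΨ0 hΨs hT hflm mH0 hfl0 hfl1
    (fun _ _ => zero_le_one) (fun _ _ => le_rfl)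
  have cf1 : ∫ x, ∫ a, Ψ x a * fl x a * Ψ a (T x) ∂ρ ∂ρ = ∫ x, ∫ a, (Ψ x a * fl x a) * (Ψ a (T x) * 1) ∂ρ ∂ρ :=
    weight0_eq_pq (fun x a => fl x a) (fun _ _ => (1 : ℝ)) (fun x a => fl x a) T (fun _ _ => by ring)
  have cf2 : ∫ x, ∫ a, Ψ x a * fl x a * Ψ a x ∂ρ ∂ρ = ∫ x, ∫ a, (Ψ x a * fl x a) * (Ψ a x * fl x a) ∂ρ ∂ρ :=
    weight0_eq_pq (fun x a => fl x a) (fun x a => fl x a) (fun x a => fl x a) (fun x => x) (fun x a => by rw [ind_mul_self])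
  rw [← cf1, ← cf2, ← c11] at E2
  have E3 := cs_term0 (ρ := ρ) (f := fun _ _ => (1 : ℝ)) (g := fun y b => fl y b) hΨm hΨb hΨ0 hΨs hT mH0 hflm
    (fun _ _ => zero_le_one) (fun _ _ => le_rfl) hfl0 hfl1
  have cg1 : ∫ x, ∫ a, Ψ x a * fl (T x) a * Ψ a (T x) ∂ρ ∂ρ = ∫ x, ∫ a, (Ψ x a * 1) * (Ψ a (T x) * fl (T x) a) ∂ρ ∂ρ :=
    weight0_eq_pq (fun _ _ => (1 : ℝ)) (fun x a => fl (T x) a) (fun x a => fl (T x) a) T (fun _ _ => by ring)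
  rw [← cg1, ← cf2, ← c11] at E3
  have total : ∫ x, ∫ a, Ψ x a * Ψ a (T x) ∂ρ ∂ρ ≤
      Real.sqrt (∫ x, ∫ a, Ψ x a * z x * Ψ a x ∂ρ ∂ρ) * Real.sqrt (∫ x, ∫ a, Ψ x a * Ψ a x ∂ρ ∂ρ) +
        Real.sqrt (∫ x, ∫ a, Ψ x a * fl x a * Ψ a x ∂ρ ∂ρ) * Real.sqrt (∫ x, ∫ a, Ψ x a * Ψ a x ∂ρ ∂ρ) +
        Real.sqrt (∫ x, ∫ a, Ψ x a * Ψ a x ∂ρ ∂ρ) * Real.sqrt (∫ x, ∫ a, Ψ x a * fl x a * Ψ a x ∂ρ ∂ρ) := by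
    linarith
  refine total.trans (le_of_eq ?_)
  ring

/-! ## §4 The odd ring -/

/-- ★ **`stub_oddRing`** (registered stub of the birth skeleton of crux ⟨stmt-QuantumFields-23707⟩, signature `OddRingP` verbatim): flux
reflection on an odd ring for a wall-labelled sector with a positive semi-definite middle-bond kernel `K` and wall-locality on close pairs,
`∫ΨKΨ(·,T·) ≤ (∫ΨKΨ)^{1/2}·(2√flip + √wall(x) + 2(∫Ψ𝟙_{W₀}K𝟙_{W₀}Ψ)^{1/2}) + ∫ΨK𝟙_{Clᶜ}Ψ(·,T·)` — the landed `twisted_le_odd` with the wall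
bracket `one_le_wallBracket`, each one-sided wall insertion untwisted by `cs_term`. [folklore] -/
theorem stub_oddRing : OddRingP := by
  intro Y _ ρ _ Ψ K CΨ CK hΨm hΨb hΨ0 hΨs hKm hKb hK0 hKs hPD T hT O W₀ hOm hW hOT Cl hCl hloc
  have hTm : Measurable T := hT.measurable
  -- the insertions
  set z : Y → ℝ := fun x => W₀.indicator (fun _ => (1 : ℝ)) x with hz
  set fl : Y → Y → ℝ := fun x b => {b | O b ≠ O x}.indicator (fun _ => (1 : ℝ)) b with hfl
  set cl : Y → Y → ℝ := fun a a' => Clᶜ.indicator (fun _ => (1 : ℝ)) (a, a') with hcl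
  -- measurability
  have hzm : Measurable z := measurable_const.indicator hW
  have hflm : Measurable (uncurry fl) := measurable_flipIndNat hOm
  have hclm : Measurable (uncurry cl) := measurable_const.indicator hCl.compl
  have p1 : Measurable fun p : Y × Y × Y => p.1 := measurable_fst
  have p2 : Measurable fun p : Y × Y × Y => p.2.1 := measurable_fst.comp measurable_snd
  have p3 : Measurable fun p : Y × Y × Y => p.2.2 := measurable_snd.comp measurable_snd
  -- three-slot insertions
  have mH0 : Measurable fun _ : Y × Y × Y => (1 : ℝ) := measurable_const
  have mZ : Measurable fun p : Y × Y × Y => z p.1 := hzm.comp p1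
  have mF1 : Measurable fun p : Y × Y × Y => fl p.1 p.2.1 := hflm.comp (p1.prodMk p2)
  have mF2 : Measurable fun p : Y × Y × Y => fl (T p.1) p.2.2 := hflm.comp ((hTm.comp p1).prodMk p3)
  have mC : Measurable fun p : Y × Y × Y => cl p.2.1 p.2.2 := hclm.comp (p2.prodMk p3)
  have mWA : Measurable fun p : Y × Y × Y => z p.2.1 := hzm.comp p2
  have mWA' : Measurable fun p : Y × Y × Y => z p.2.2 := hzm.comp p3
  have mMid : Measurable fun p : Y × Y × Y => cl p.2.1 p.2.2 + z p.2.1 + z p.2.2 := (mC.add mWA).add mWA'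
  -- bounds
  have b1 : ∀ (s : Set Y) (y : Y), |s.indicator (fun _ => (1 : ℝ)) y| ≤ 1 := abs_ind_le_one
  have bZ : ∀ x a a' : Y, |z x| ≤ 1 := fun x _ _ => b1 _ x
  have bF1 : ∀ x a a' : Y, |fl x a| ≤ 1 := fun x a _ => b1 _ a
  have bF2 : ∀ x a a' : Y, |fl (T x) a'| ≤ 1 := fun x _ a' => b1 _ a'
  have bC : ∀ x a a' : Y, |cl a a'| ≤ 1 := fun _ a a' => abs_ind_le_one (Y := Y × Y) _ (a, a')
  have bWA : ∀ x a a' : Y, |z a| ≤ 1 := fun _ a _ => b1 _ a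
  have bWA' : ∀ x a a' : Y, |z a'| ≤ 1 := fun _ _ a' => b1 _ a'
  have bH0 : ∀ x a a' : Y, |(1 : ℝ)| ≤ 1 := fun _ _ _ => by simp
  have bMid : ∀ x a a' : Y, |cl a a' + z a + z a'| ≤ 3 := fun x a a' => by
    have h1 := bC x a a'; have h2 := bWA x a a'; have h3 := bWA' x a a'
    calc |cl a a' + z a + z a'| ≤ |cl a a' + z a| + |z a'| := abs_add_le _ _
      _ ≤ |cl a a'| + |z a| + |z a'| := by linarith [abs_add_le (cl a a') (z a)]
      _ ≤ 3 := by linarith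
  have bCW : ∀ x a a' : Y, |cl a a' + z a| ≤ 2 := fun x a a' => by
    linarith [abs_add_le (cl a a') (z a), bC x a a', bWA x a a']
  have bZF : ∀ x a a' : Y, |z x + fl x a| ≤ 2 := fun x a a' => by
    linarith [abs_add_le (z x) (fl x a), bZ x a a', bF1 x a a']
  have bZFF : ∀ x a a' : Y, |z x + fl x a + fl (T x) a'| ≤ 3 := fun x a a' => by
    linarith [abs_add_le (z x + fl x a) (fl (T x) a'), bZF x a a', bF2 x a a']
  have bBr : ∀ x a a' : Y, |z x + fl x a + fl (T x) a' + (cl a a' + z a + z a')| ≤ 6 := fun x a a' => by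
    linarith [abs_add_le (z x + fl x a + fl (T x) a') (cl a a' + z a + z a'), bZFF x a a', bMid x a a']
  -- Step 1: insert the bracket
  have step1 : ∫ x, ∫ a, Ψ x a * ∫ a', K a a' * 1 * Ψ a' (T x) ∂ρ ∂ρ ∂ρ ≤
      ∫ x, ∫ a, Ψ x a * ∫ a', K a a' * (z x + fl x a + fl (T x) a' + (cl a a' + z a + z a')) * Ψ a' (T x) ∂ρ ∂ρ ∂ρ :=
    weight_mono (H := fun _ _ _ => (1 : ℝ)) (H' := fun x a a' => z x + fl x a + fl (T x) a' + (cl a a' + z a + z a')) hΨm hΨb hΨ0 hKm hKb hK0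
      mH0 (((mZ.add mF1).add mF2).add mMid) bH0 bBr (fun x a a' => one_le_wallBracket hOT hloc x a a') hTm
  have e0 : ∫ x, ∫ a, Ψ x a * ∫ a', K a a' * 1 * Ψ a' (T x) ∂ρ ∂ρ ∂ρ = ∫ x, ∫ a, Ψ x a * ∫ a', K a a' * Ψ a' (T x) ∂ρ ∂ρ ∂ρ := by
    simp only [mul_one]
  -- Step 2: split the bracket
  have e2a : ∫ x, ∫ a, Ψ x a * ∫ a', K a a' * (z x + fl x a + fl (T x) a' + (cl a a' + z a + z a')) * Ψ a' (T x) ∂ρ ∂ρ ∂ρ =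
      (∫ x, ∫ a, Ψ x a * ∫ a', K a a' * (z x + fl x a + fl (T x) a') * Ψ a' (T x) ∂ρ ∂ρ ∂ρ) +
        ∫ x, ∫ a, Ψ x a * ∫ a', K a a' * (cl a a' + z a + z a') * Ψ a' (T x) ∂ρ ∂ρ ∂ρ :=
    weight_add (H := fun x a a' => z x + fl x a + fl (T x) a') (H' := fun _ a a' => cl a a' + z a + z a') hΨm hΨb hKm hKb
      ((mZ.add mF1).add mF2) mMid bZFF bMid hTm
  have e2b : ∫ x, ∫ a, Ψ x a * ∫ a', K a a' * (z x + fl x a + fl (T x) a') * Ψ a' (T x) ∂ρ ∂ρ ∂ρ =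
      (∫ x, ∫ a, Ψ x a * ∫ a', K a a' * (z x + fl x a) * Ψ a' (T x) ∂ρ ∂ρ ∂ρ) +
        ∫ x, ∫ a, Ψ x a * ∫ a', K a a' * fl (T x) a' * Ψ a' (T x) ∂ρ ∂ρ ∂ρ :=
    weight_add (H := fun x a _ => z x + fl x a) (H' := fun x _ a' => fl (T x) a') hΨm hΨb hKm hKb (mZ.add mF1) mF2 bZF bF2 hTm
  have e2c : ∫ x, ∫ a, Ψ x a * ∫ a', K a a' * (z x + fl x a) * Ψ a' (T x) ∂ρ ∂ρ ∂ρ =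
      (∫ x, ∫ a, Ψ x a * ∫ a', K a a' * z x * Ψ a' (T x) ∂ρ ∂ρ ∂ρ) +
        ∫ x, ∫ a, Ψ x a * ∫ a', K a a' * fl x a * Ψ a' (T x) ∂ρ ∂ρ ∂ρ :=
    weight_add (H := fun x _ _ => z x) (H' := fun x a _ => fl x a) hΨm hΨb hKm hKb mZ mF1 bZ bF1 hTm
  have e2d : ∫ x, ∫ a, Ψ x a * ∫ a', K a a' * (cl a a' + z a + z a') * Ψ a' (T x) ∂ρ ∂ρ ∂ρ =
      (∫ x, ∫ a, Ψ x a * ∫ a', K a a' * (cl a a' + z a) * Ψ a' (T x) ∂ρ ∂ρ ∂ρ) +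
        ∫ x, ∫ a, Ψ x a * ∫ a', K a a' * z a' * Ψ a' (T x) ∂ρ ∂ρ ∂ρ :=
    weight_add (H := fun _ a a' => cl a a' + z a) (H' := fun _ _ a' => z a') hΨm hΨb hKm hKb (mC.add mWA) mWA' bCW bWA' hTm
  have e2e : ∫ x, ∫ a, Ψ x a * ∫ a', K a a' * (cl a a' + z a) * Ψ a' (T x) ∂ρ ∂ρ ∂ρ =
      (∫ x, ∫ a, Ψ x a * ∫ a', K a a' * cl a a' * Ψ a' (T x) ∂ρ ∂ρ ∂ρ) +
        ∫ x, ∫ a, Ψ x a * ∫ a', K a a' * z a * Ψ a' (T x) ∂ρ ∂ρ ∂ρ :=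
    weight_add (H := fun _ a a' => cl a a') (H' := fun _ a _ => z a) hΨm hΨb hKm hKb mC mWA bC bWA hTm
  -- Step 3: the five Cauchy–Schwarz bounds
  have hz0 : ∀ x a : Y, 0 ≤ z x := fun x _ => ind_nonneg _ x
  have hz1 : ∀ x a : Y, z x ≤ 1 := fun x _ => ind_le_one _ x
  have hfl0 : ∀ x a : Y, 0 ≤ fl x a := fun x a => ind_nonneg _ a
  have hfl1 : ∀ x a : Y, fl x a ≤ 1 := fun x a => ind_le_one _ a
  have hw0 : ∀ x a : Y, 0 ≤ z a := fun _ a => ind_nonneg _ a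
  have hw1 : ∀ x a : Y, z a ≤ 1 := fun _ a => ind_le_one _ a
  -- (E1) the wall at the base point
  have E1 := cs_term (ρ := ρ) (f := fun x _ => z x) (g := fun _ _ => (1 : ℝ)) hΨm hΨb hΨ0 hΨs hKm hKb hK0 hKs hPD hT
    (hzm.comp measurable_fst) measurable_const hz0 hz1 (fun _ _ => zero_le_one) (fun _ _ => le_rfl)
  have cz1 : ∫ x, ∫ a, Ψ x a * ∫ a', K a a' * z x * Ψ a' (T x) ∂ρ ∂ρ ∂ρ =
      ∫ x, ∫ a, (Ψ x a * z x) * ∫ a', K a a' * (Ψ a' (T x) * 1) ∂ρ ∂ρ ∂ρ :=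
    weight_eq_pq (fun x _ => z x) (fun _ _ => (1 : ℝ)) (fun x _ _ => z x) T (fun _ _ _ => by ring)
  have cz2 : ∫ x, ∫ a, Ψ x a * ∫ a', K a a' * z x * Ψ a' x ∂ρ ∂ρ ∂ρ =
      ∫ x, ∫ a, (Ψ x a * z x) * ∫ a', K a a' * (Ψ a' x * z x) ∂ρ ∂ρ ∂ρ :=
    weight_eq_pq_id (fun x _ => z x) (fun x _ => z x) (fun x _ _ => z x) (fun x _ _ => by rw [ind_mul_self])
  have c11 : ∫ x, ∫ a, Ψ x a * ∫ a', K a a' * Ψ a' x ∂ρ ∂ρ ∂ρ = ∫ x, ∫ a, (Ψ x a * 1) * ∫ a', K a a' * (Ψ a' x * 1) ∂ρ ∂ρ ∂ρ := by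
    simp only [mul_one]
  rw [← cz1, ← cz2, ← c11] at E1
  -- (E2) flip on the first half
  have E2 := cs_term (ρ := ρ) (f := fun x a => fl x a) (g := fun _ _ => (1 : ℝ)) hΨm hΨb hΨ0 hΨs hKm hKb hK0 hKs hPD hT
    hflm measurable_const hfl0 hfl1 (fun _ _ => zero_le_one) (fun _ _ => le_rfl)
  have cf1 : ∫ x, ∫ a, Ψ x a * ∫ a', K a a' * fl x a * Ψ a' (T x) ∂ρ ∂ρ ∂ρ =
      ∫ x, ∫ a, (Ψ x a * fl x a) * ∫ a', K a a' * (Ψ a' (T x) * 1) ∂ρ ∂ρ ∂ρ :=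
    weight_eq_pq (fun x a => fl x a) (fun _ _ => (1 : ℝ)) (fun x a _ => fl x a) T (fun _ _ _ => by ring)
  have cf2 : ∫ x, ∫ a, Ψ x a * ∫ a', K a a' * (fl x a * fl x a') * Ψ a' x ∂ρ ∂ρ ∂ρ =
      ∫ x, ∫ a, (Ψ x a * fl x a) * ∫ a', K a a' * (Ψ a' x * fl x a') ∂ρ ∂ρ ∂ρ :=
    weight_eq_pq_id (fun x a => fl x a) (fun x a' => fl x a') (fun x a a' => fl x a * fl x a') (fun _ _ _ => rfl)
  rw [← cf1, ← cf2, ← c11] at E2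
  -- (E3) flip on the second half
  have E3 := cs_term (ρ := ρ) (f := fun _ _ => (1 : ℝ)) (g := fun y b => fl y b) hΨm hΨb hΨ0 hΨs hKm hKb hK0 hKs hPD hT
    measurable_const hflm (fun _ _ => zero_le_one) (fun _ _ => le_rfl) hfl0 hfl1
  have cg1 : ∫ x, ∫ a, Ψ x a * ∫ a', K a a' * fl (T x) a' * Ψ a' (T x) ∂ρ ∂ρ ∂ρ =
      ∫ x, ∫ a, (Ψ x a * 1) * ∫ a', K a a' * (Ψ a' (T x) * fl (T x) a') ∂ρ ∂ρ ∂ρ :=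
    weight_eq_pq (fun _ _ => (1 : ℝ)) (fun x a' => fl (T x) a') (fun x _ a' => fl (T x) a') T (fun _ _ _ => by ring)
  rw [← cg1, ← cf2, ← c11] at E3
  -- (E4) the wall at the end of the first half
  have E4 := cs_term (ρ := ρ) (f := fun _ a => z a) (g := fun _ _ => (1 : ℝ)) hΨm hΨb hΨ0 hΨs hKm hKb hK0 hKs hPD hT
    (hzm.comp measurable_snd) measurable_const hw0 hw1 (fun _ _ => zero_le_one) (fun _ _ => le_rfl)
  have cw1 : ∫ x, ∫ a, Ψ x a * ∫ a', K a a' * z a * Ψ a' (T x) ∂ρ ∂ρ ∂ρ =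
      ∫ x, ∫ a, (Ψ x a * z a) * ∫ a', K a a' * (Ψ a' (T x) * 1) ∂ρ ∂ρ ∂ρ :=
    weight_eq_pq (fun _ a => z a) (fun _ _ => (1 : ℝ)) (fun _ a _ => z a) T (fun _ _ _ => by ring)
  have cw2 : ∫ x, ∫ a, Ψ x a * ∫ a', K a a' * (z a * z a') * Ψ a' x ∂ρ ∂ρ ∂ρ =
      ∫ x, ∫ a, (Ψ x a * z a) * ∫ a', K a a' * (Ψ a' x * z a') ∂ρ ∂ρ ∂ρ :=
    weight_eq_pq_id (fun _ a => z a) (fun _ a' => z a') (fun _ a a' => z a * z a') (fun _ _ _ => rfl)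
  rw [← cw1, ← cw2, ← c11] at E4
  -- (E5) the wall at the start of the second half
  have E5 := cs_term (ρ := ρ) (f := fun _ _ => (1 : ℝ)) (g := fun _ b => z b) hΨm hΨb hΨ0 hΨs hKm hKb hK0 hKs hPD hT
    measurable_const (hzm.comp measurable_snd) (fun _ _ => zero_le_one) (fun _ _ => le_rfl) hw0 hw1
  have cv1 : ∫ x, ∫ a, Ψ x a * ∫ a', K a a' * z a' * Ψ a' (T x) ∂ρ ∂ρ ∂ρ =
      ∫ x, ∫ a, (Ψ x a * 1) * ∫ a', K a a' * (Ψ a' (T x) * z a') ∂ρ ∂ρ ∂ρ :=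
    weight_eq_pq (fun _ _ => (1 : ℝ)) (fun _ a' => z a') (fun _ _ a' => z a') T (fun _ _ _ => by ring)
  rw [← cv1, ← cw2, ← c11] at E5
  -- Step 4: collect
  have total : ∫ x, ∫ a, Ψ x a * ∫ a', K a a' * Ψ a' (T x) ∂ρ ∂ρ ∂ρ ≤
      Real.sqrt (∫ x, ∫ a, Ψ x a * ∫ a', K a a' * z x * Ψ a' x ∂ρ ∂ρ ∂ρ) *
          Real.sqrt (∫ x, ∫ a, Ψ x a * ∫ a', K a a' * Ψ a' x ∂ρ ∂ρ ∂ρ) +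
        Real.sqrt (∫ x, ∫ a, Ψ x a * ∫ a', K a a' * (fl x a * fl x a') * Ψ a' x ∂ρ ∂ρ ∂ρ) *
          Real.sqrt (∫ x, ∫ a, Ψ x a * ∫ a', K a a' * Ψ a' x ∂ρ ∂ρ ∂ρ) +
        Real.sqrt (∫ x, ∫ a, Ψ x a * ∫ a', K a a' * Ψ a' x ∂ρ ∂ρ ∂ρ) *
          Real.sqrt (∫ x, ∫ a, Ψ x a * ∫ a', K a a' * (fl x a * fl x a') * Ψ a' x ∂ρ ∂ρ ∂ρ) +
        Real.sqrt (∫ x, ∫ a, Ψ x a * ∫ a', K a a' * (z a * z a') * Ψ a' x ∂ρ ∂ρ ∂ρ) *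
          Real.sqrt (∫ x, ∫ a, Ψ x a * ∫ a', K a a' * Ψ a' x ∂ρ ∂ρ ∂ρ) +
        Real.sqrt (∫ x, ∫ a, Ψ x a * ∫ a', K a a' * Ψ a' x ∂ρ ∂ρ ∂ρ) *
          Real.sqrt (∫ x, ∫ a, Ψ x a * ∫ a', K a a' * (z a * z a') * Ψ a' x ∂ρ ∂ρ ∂ρ) +
        ∫ x, ∫ a, Ψ x a * ∫ a', K a a' * cl a a' * Ψ a' (T x) ∂ρ ∂ρ ∂ρ := by
    linarith
  refine total.trans (le_of_eq ?_)
  ring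

end Summit.QuantumFields.YangMills.Theorems.CentreWallReflection

end
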